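import Mathlib
import HarnessLib
import Literature.Combinatorics.Additive.KempermanElementaryPairs

/-!
# Sums with a progression having one hole, in a cyclic group (Grynkiewicz 2009, Lemma 5.10: the count)

[cite: Grynkiewicz2009, Lemma 5.10 (proof)] [tag: critical-pair] [tag: inverse-theorem]

Topic `Literature/Combinatorics/Additive`.  Cell `mm-stpp` (D-0046), seat `mm-stpp-lit` (gen 23); the
port of D. J. Grynkiewicz, *A step beyond Kemperman's structure theorem*, Mathematika **55** (2009)
67–114, continued.  This file holds the COUNTING CORE of the proof of Lemma 5.10 (print pp. 21–22;
arXiv:0710.1041v2 Lemma 4.14), in the normalised position the proof reaches after «By translating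
and considering `−A` and `−B` if necessary, we may w.l.o.g. assume `0, d ∈ A`, and that `0` is the
first term of the minimal arithmetic progression with difference `d` containing `A`.  Since
`⟨d⟩ = G`, let `B₁, …, B_c` be the `d`-components of `B` cyclicly ordered according to the direction
given by `d`.  Let `B'_i` be the `d`-component of `B̄` located between `B_i` and `B_{i+1}` … Observe,
since `0` and `d` are the first two terms in `A`, that for each `i` either at least
`min{|A|, |B'_i|}` of the holes contained in `B'_i` are elements of `A + B`, or else `|B_i| = 1` and at
least `max{1, min{|A| − 1, |B'_i| − 1}}` of the holes contained in `B'_i` are elements of `A + B`»;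
the lemma itself (general position, the reductions, Lemma 5.9) is `OneHoleProgressionTransfer.lean`.

BOOKKEEPING (ours).  For `⟨d⟩ = G` finite, the gaps `B'_i` are indexed by their first elements, the
GAP STARTS `g ∈ (d + B) ∖ B` (`g ∉ B`, `g − d ∈ B`; there are `c_d(B)` of them,
`componentCount_eq_card_vadd_sdiff`); the gap issued from `g` is `{g, g + d, …, g + (m_g − 1) d}` with
`m_g ≥ 1` the first return time to `B` (`exists_gapLength`); the gaps are pairwise disjoint
(`eq_of_gap_eq`) and cover `B̄` (`exists_gapStart_of_notMem`); «`|B_i| = 1`» for the component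
preceding the gap at `g` reads `g − 2d ∉ B`.  `A = {0, d, …, ℓ d} ∖ {j d}` with `2 ≤ j ≤ ℓ − 1`
(`|A| = ℓ`).

MAIN RESULTS (0 definitions, 0 named facts; everything PROVED).
* `Grynkiewicz2009.exists_gapLength`, `eq_of_gap_eq`, `exists_gapStart_of_notMem`,
  `exists_gapStart_sub_two_mem` — gaps of a set in a finite cyclic group `⟨d⟩`.
* `Grynkiewicz2009.add_nsmul_mem_add_of_gapStart` (`'`) — the observation quoted above: the first
  `min{|A|, m_g}` elements of the gap at `g` lie in `A + B`, except possibly `g + (j − 1) d` when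
  `g − 2d ∉ B`.
* `Grynkiewicz2009.componentCount_le_of_oneHole` — «`|A + B| = |B| + 3` implies `c ≤ 3`» (every gap
  start lies in `(A + B) ∖ B`, so `c_d(B) ≤ |A|`).
* `Grynkiewicz2009.oneHole_two_gaps` — the case `c_d(B) = 2`: one gap is a single element `β`,
  `B ∪ {β}` is a progression with difference `d` (so `d⊆(B, 𝒬𝒜𝒫_d) = 1`) and
  `|{0, …, ℓ d} + (B ∪ {β})| = ℓ + 1 + |B|` — «Letting `α` be the hole in `A`, and letting `β` be the
  hole in `B` yields (17)»; its two halves are `gapLength_eq_one_of_long` (a long gap forces the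
  other gap to be a single hole — the count (38) with `x ≤ 1`) and `oneHole_conclusion`.
* `Grynkiewicz2009.oneHole_three_gaps` — the case `|A| = 3`, `c = 3` is impossible («since each `B'_i`
  contributes at least one to the sumset, and since `B'_3` contributes at least `|A| − 1` … again a
  contradiction»).

## References
* D. J. Grynkiewicz, *A step beyond Kemperman's structure theorem*, Mathematika 55 (2009) 67–114,
  doi:10.1112/S0025579300000966, Lemma 5.10 (pp. 21–22); arXiv:0710.1041v2 Lemma 4.14
  [cite: Grynkiewicz2009, Lemma 5.10] — held `paper:doi-10-1112-s0025579300000966` /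
  `paper:arxiv-0710.1041`, read 2026-08-29.
-/

namespace Literature.Combinatorics.Additive

open Finset
open scoped Pointwise

universe u

namespace Grynkiewicz2009

variable {G : Type u} [AddCommGroup G] [DecidableEq G]

/-! ### Walking along `d` in `G = ⟨d⟩` -/

/-- In `G = ⟨d⟩` (finite) every `y` is `x + k d` with `k < |G|`. [cite: Grynkiewicz2009, Lemma 5.10
(proof, «Since ⟨d⟩ = G»)] -/
theorem exists_eq_add_nsmul_of_zmultiples_eq_top [Fintype G] {d : G} (hd : AddSubgroup.zmultiples d = ⊤)
    (x y : G) : ∃ k, k < Fintype.card G ∧ y = x + k • d := by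
  have hmem : y - x ∈ (AddSubgroup.zmultiples d : Set G) := by
    rw [hd, AddSubgroup.coe_top]; exact Set.mem_univ _
  rw [Isoperimetric.coe_zmultiples_eq_coe_apFinset, mem_coe, mem_apFinset] at hmem
  obtain ⟨k, hk, hk'⟩ := hmem
  refine ⟨k, by rwa [← Isoperimetric.addOrderOf_eq_card_of_zmultiples_eq_top hd], ?_⟩
  rw [zero_add] at hk'
  rw [hk', add_sub_cancel]

omit [DecidableEq G] in
/-- Multiples `k d`, `k < |G|`, are distinct in `G = ⟨d⟩`. [cite: Grynkiewicz2009, §2 («note these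
terms are uniquely defined, relative to d, for l < ⟨d⟩»)] -/
theorem nsmul_inj_of_lt [Fintype G] {d : G} (hd : AddSubgroup.zmultiples d = ⊤) {k k' : ℕ}
    (hk : k < Fintype.card G) (hk' : k' < Fintype.card G) (h : k • d = k' • d) : k = k' := by
  rw [← Isoperimetric.addOrderOf_eq_card_of_zmultiples_eq_top hd] at hk hk'
  exact nsmul_injOn_Iio_addOrderOf (Set.mem_Iio.2 hk) (Set.mem_Iio.2 hk') h

/-! ### Gaps of `B` in `G = ⟨d⟩` -/

/-- `g` is a gap start of `B` (in direction `d`) iff `g ∉ B` and `g − d ∈ B`; the gap starts form the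
finset `(d + B) ∖ B`, of size `c_d(B)` (`componentCount_eq_card_vadd_sdiff`).
[cite: Grynkiewicz2009, Lemma 5.10 (proof, the d-components B'_i of B̄)] -/
theorem mem_vadd_sdiff_iff {B : Finset G} {d g : G} : g ∈ (d +ᵥ B) \ B ↔ g ∉ B ∧ g - d ∈ B := by
  rw [mem_sdiff, mem_vadd_finset]
  constructor
  · rintro ⟨⟨b, hb, rfl⟩, hg⟩
    exact ⟨hg, by rwa [vadd_eq_add, add_sub_cancel_left]⟩
  · rintro ⟨hg, hb⟩
    exact ⟨⟨g - d, hb, by rw [vadd_eq_add, add_sub_cancel]⟩, hg⟩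

/-- **Gap lengths.**  In `G = ⟨d⟩` finite with `B ≠ ∅`, every `g ∉ B` has a first return time
`m_g ≥ 1` (`m_g < |G|`): `g, g + d, …, g + (m_g − 1) d ∉ B` and `g + m_g d ∈ B` — for a gap start
`g` this is the gap `B'_i` issued from `g` and `m_g = |B'_i|`.
[cite: Grynkiewicz2009, Lemma 5.10 (proof, the d-components B'_i of B̄)] -/
theorem exists_gapLength [Fintype G] {B : Finset G} {d : G} (hd : AddSubgroup.zmultiples d = ⊤)
    (hB : B.Nonempty) :
    ∃ m : G → ℕ, ∀ g, g ∉ B →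
      1 ≤ m g ∧ m g < Fintype.card G ∧ g + m g • d ∈ B ∧ ∀ i < m g, g + i • d ∉ B := by
  classical
  obtain ⟨b, hb⟩ := hB
  have hex : ∀ g : G, ∃ k : ℕ, g + k • d ∈ B := fun g => by
    obtain ⟨k, -, hk⟩ := exists_eq_add_nsmul_of_zmultiples_eq_top hd g b
    exact ⟨k, hk ▸ hb⟩
  refine ⟨fun g => Nat.find (hex g), fun g hg => ⟨?_, ?_, Nat.find_spec (hex g), fun i hi => ?_⟩⟩
  · show 1 ≤ Nat.find (hex g)
    rw [Nat.one_le_iff_ne_zero]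
    intro h0
    have := Nat.find_spec (hex g)
    rw [h0, zero_nsmul, add_zero] at this
    exact hg this
  · show Nat.find (hex g) < Fintype.card G
    obtain ⟨k, hk, hkb⟩ := exists_eq_add_nsmul_of_zmultiples_eq_top hd g b
    exact lt_of_le_of_lt (Nat.find_min' (hex g) (by rw [← hkb]; exact hb)) hk
  · exact Nat.find_min (hex g) (show i < Nat.find (hex g) from hi)

omit [DecidableEq G] in
/-- Two gaps sharing an element coincide (one direction of the bookkeeping: `i ≤ i'`).
[cite: Grynkiewicz2009, Lemma 5.10 (proof, «G is the disjoint union of the B_i and B'_i»)] -/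
theorem eq_of_gap_eq_aux {B : Finset G} {d : G} {m : G → ℕ}
    (hm : ∀ g, g ∉ B → ∀ i < m g, g + i • d ∉ B) {g g' : G} (hg : g - d ∈ B) (hg'B : g' ∉ B)
    {i i' : ℕ} (hi' : i' < m g') (hle : i ≤ i') (h : g + i • d = g' + i' • d) :
    g = g' ∧ i = i' := by
  rcases hle.eq_or_lt with heq | hlt
  · subst heq
    exact ⟨add_right_cancel h, rfl⟩
  · exfalso
    obtain ⟨t, rfl⟩ : ∃ t, i' = i + (t + 1) := ⟨i' - i - 1, by omega⟩
    have h1 : g = g' + (t + 1) • d := by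
      have h2 : g + i • d = g' + (t + 1) • d + i • d := by rw [h, add_nsmul]; abel
      exact add_right_cancel h2
    have h3 : g - d = g' + t • d := by rw [h1, succ_nsmul]; abel
    exact hm g' hg'B t (by omega) (h3 ▸ hg)

omit [DecidableEq G] in
/-- **The gaps are pairwise disjoint**: if `g + i d = g' + i' d` with `g, g'` gap starts, `i < m_g`,
`i' < m_{g'}`, then `g = g'` and `i = i'`. [cite: Grynkiewicz2009, Lemma 5.10 (proof, «G is the
disjoint union of the B_i and B'_i»)] -/
theorem eq_of_gap_eq {B : Finset G} {d : G} {m : G → ℕ}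
    (hm : ∀ g, g ∉ B → ∀ i < m g, g + i • d ∉ B) {g g' : G} (hg : g - d ∈ B) (hgB : g ∉ B)
    (hg' : g' - d ∈ B) (hg'B : g' ∉ B) {i i' : ℕ} (hi : i < m g) (hi' : i' < m g')
    (h : g + i • d = g' + i' • d) : g = g' ∧ i = i' := by
  rcases Nat.lt_or_ge i' i with hlt | hle
  · obtain ⟨h1, h2⟩ := eq_of_gap_eq_aux hm hg' hgB hi hlt.le h.symm
    exact ⟨h1.symm, h2.symm⟩
  · exact eq_of_gap_eq_aux hm hg hg'B hi' hle h

/-- **The gaps cover `B̄`**: every `x ∉ B` is `g + i d` for a gap start `g` and some `i < m_g`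
(walk back from `x` to the last element of `B` before it). [cite: Grynkiewicz2009, Lemma 5.10
(proof, «G is the disjoint union of the B_i and B'_i»)] -/
theorem exists_gapStart_of_notMem [Fintype G] {B : Finset G} {d : G} (hd : AddSubgroup.zmultiples d = ⊤)
    (hB : B.Nonempty) {m : G → ℕ} (hm' : ∀ g, g ∉ B → g + m g • d ∈ B) {x : G} (hx : x ∉ B) :
    ∃ g, g ∉ B ∧ g - d ∈ B ∧ ∃ i < m g, x = g + i • d := by
  classical
  have hex : ∃ t : ℕ, x - (t + 1) • d ∈ B := by
    obtain ⟨b, hb⟩ := hB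
    obtain ⟨k, -, hkx⟩ := exists_eq_add_nsmul_of_zmultiples_eq_top hd b x
    have hk0 : k ≠ 0 := by
      rintro rfl
      rw [zero_nsmul, add_zero] at hkx
      exact hx (hkx ▸ hb)
    refine ⟨k - 1, ?_⟩
    rw [Nat.sub_add_cancel (Nat.one_le_iff_ne_zero.2 hk0), hkx, add_sub_cancel_right]
    exact hb
  obtain ⟨t, htB, hmin⟩ : ∃ t : ℕ, x - (t + 1) • d ∈ B ∧ ∀ s < t, x - (s + 1) • d ∉ B :=
    ⟨Nat.find hex, Nat.find_spec hex, fun s hs => Nat.find_min hex hs⟩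
  have hgB : x - t • d ∉ B := by
    rcases Nat.eq_zero_or_pos t with h0 | hpos
    · rw [h0, zero_nsmul, sub_zero]; exact hx
    · have := hmin (t - 1) (by omega)
      rwa [Nat.sub_add_cancel hpos] at this
  refine ⟨x - t • d, hgB, by rw [sub_sub, ← succ_nsmul]; exact htB, t, ?_, by rw [sub_add_cancel]⟩
  by_contra hle
  push Not at hle
  obtain ⟨μ, hμ⟩ : ∃ μ, m (x - t • d) = μ := ⟨_, rfl⟩
  have h1 := hm' (x - t • d) hgB
  rw [hμ] at hle h1
  obtain ⟨r, rfl⟩ : ∃ r, t = μ + r := ⟨t - μ, by omega⟩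
  have h2 : x - (μ + r) • d + μ • d = x - r • d := by
    rw [add_nsmul]; abel
  rw [h2] at h1
  rcases Nat.eq_zero_or_pos r with h0 | hpos
  · rw [h0, zero_nsmul, sub_zero] at h1; exact hx h1
  · have := hmin (r - 1) (by omega)
    rw [Nat.sub_add_cancel hpos] at this
    exact this h1

/-- **A component with at least two elements** («or else `|B_i| = 1`»): in `G = ⟨d⟩` finite with
`B ≠ G`, if some `b ∈ B` has `b + d ∈ B`, then some gap start `g` has `g − 2d ∈ B` (walk forward from
`b` to the end of its component). [cite: Grynkiewicz2009, Lemma 5.10 (proof)] -/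
theorem exists_gapStart_sub_two_mem [Fintype G] {B : Finset G} {d : G} (hd : AddSubgroup.zmultiples d = ⊤)
    (hBc : Bᶜ.Nonempty) {b : G} (hb : b ∈ B) (hbd : b + d ∈ B) :
    ∃ g, g ∉ B ∧ g - d ∈ B ∧ g - d - d ∈ B := by
  classical
  have hex : ∃ t : ℕ, b + (t + 2) • d ∉ B := by
    obtain ⟨x, hx⟩ := hBc
    rw [mem_compl] at hx
    obtain ⟨k, -, hkx⟩ := exists_eq_add_nsmul_of_zmultiples_eq_top hd b x
    have hk2 : 2 ≤ k := by
      by_contra hlt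
      push Not at hlt
      interval_cases k
      · rw [zero_nsmul, add_zero] at hkx; exact hx (hkx ▸ hb)
      · rw [one_nsmul] at hkx; exact hx (hkx ▸ hbd)
    exact ⟨k - 2, by rw [Nat.sub_add_cancel hk2, ← hkx]; exact hx⟩
  obtain ⟨t, ht, hmin⟩ : ∃ t : ℕ, b + (t + 2) • d ∉ B ∧ ∀ s < t, b + (s + 2) • d ∈ B :=
    ⟨Nat.find hex, Nat.find_spec hex, fun s hs => by have := Nat.find_min hex hs; push Not at this; exact this⟩
  refine ⟨b + (t + 2) • d, ht, ?_, ?_⟩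
  · have h1 : b + (t + 2) • d - d = b + (t + 1) • d := by
      rw [show t + 2 = (t + 1) + 1 from rfl, succ_nsmul]; abel
    rw [h1]
    rcases Nat.eq_zero_or_pos t with h0 | hpos
    · rw [h0, zero_add, one_nsmul]; exact hbd
    · have := hmin (t - 1) (by omega)
      rwa [show t - 1 + 2 = t + 1 by omega] at this
  · have h1 : b + (t + 2) • d - d - d = b + t • d := by
      rw [show t + 2 = t + 1 + 1 from rfl, succ_nsmul, succ_nsmul]; abel
    rw [h1]
    rcases Nat.lt_or_ge t 2 with hlt | hge
    · interval_cases t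
      · rw [zero_nsmul, add_zero]; exact hb
      · rw [one_nsmul]; exact hbd
    · have := hmin (t - 2) (by omega)
      rwa [Nat.sub_add_cancel hge] at this

/-- **All components singletons**: if no `b ∈ B` has `b + d ∈ B`, then `b ↦ b + d` injects `B` into
the gap starts, so `|B| ≤ c_d(B)`. [cite: Grynkiewicz2009, Lemma 5.10 (proof, «x is the number of
B_i with |B_i| = 1»)] -/
theorem card_le_componentCount_of_forall {B : Finset G} {d : G} (h : ∀ b ∈ B, b + d ∉ B) :
    #B ≤ componentCount d B := by
  rw [componentCount_eq_card_vadd_sdiff]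
  refine card_le_card_of_injOn (fun b => b + d) (fun b hb => ?_) fun b _ b' _ hbb' => ?_
  · rw [mem_coe, mem_vadd_sdiff_iff, add_sub_cancel_right]
    exact ⟨h b (mem_coe.1 hb), mem_coe.1 hb⟩
  · exact add_right_cancel hbb'

/-! ### `A = {0, d, …, ℓ d} ∖ {j d}`: which gap elements lie in `A + B` -/

/-- Membership in the one-hole progression: `k d ∈ {0, d, …, ℓ d} ∖ {j d}` for `k ≤ ℓ`, `k ≠ j`
(`ℓ < |G|`). [cite: Grynkiewicz2009, Lemma 5.10 (proof)] -/
theorem nsmul_mem_oneHole [Fintype G] {A : Finset G} {d : G} {ℓ j k : ℕ} (hd : AddSubgroup.zmultiples d = ⊤)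
    (hA : A = (apFinset (0 : G) d (ℓ + 1)).erase (j • d)) (hℓ : ℓ < Fintype.card G)
    (hjℓ : j ≤ ℓ) (hk : k ≤ ℓ) (hkj : k ≠ j) : k • d ∈ A := by
  rw [hA, mem_erase, mem_apFinset]
  refine ⟨fun h => hkj (nsmul_inj_of_lt hd (by omega) (by omega) h), k, by omega, zero_add _⟩

/-- **The observation.**  For a gap start `g` (`g − d ∈ B`) and `i < ℓ` with `i + 1 ≠ j`:
`g + i d = (g − d) + (i + 1) d ∈ A + B`. [cite: Grynkiewicz2009, Lemma 5.10 (proof, «Observe, since 0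
and d are the first two terms in A, …»)] -/
theorem add_nsmul_mem_add_of_gapStart [Fintype G] {A B : Finset G} {d : G} {ℓ j : ℕ}
    (hd : AddSubgroup.zmultiples d = ⊤) (hA : A = (apFinset (0 : G) d (ℓ + 1)).erase (j • d))
    (hℓ : ℓ < Fintype.card G) (hjℓ : j ≤ ℓ) {g : G} (hg : g - d ∈ B) {i : ℕ} (hi : i < ℓ)
    (hij : i + 1 ≠ j) : g + i • d ∈ A + B := by
  have : g + i • d = (i + 1) • d + (g - d) := by rw [succ_nsmul]; abel
  rw [this]
  exact add_mem_add (nsmul_mem_oneHole hd hA hℓ hjℓ (by omega) hij) hg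

/-- **The observation, for a component with two elements** (`g − d, g − 2d ∈ B`): then also
`g + (j − 1) d = (g − 2d) + (j + 1) d ∈ A + B`, so `g + i d ∈ A + B` for EVERY `i < ℓ` (`j + 1 ≤ ℓ`).
[cite: Grynkiewicz2009, Lemma 5.10 (proof, «at least min{|A|, |B'_i|} of the holes …»)] -/
theorem add_nsmul_mem_add_of_gapStart' [Fintype G] {A B : Finset G} {d : G} {ℓ j : ℕ}
    (hd : AddSubgroup.zmultiples d = ⊤) (hA : A = (apFinset (0 : G) d (ℓ + 1)).erase (j • d))
    (hℓ : ℓ < Fintype.card G) (hjℓ : j + 1 ≤ ℓ) {g : G} (hg : g - d ∈ B) (hg2 : g - d - d ∈ B)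
    {i : ℕ} (hi : i < ℓ) : g + i • d ∈ A + B := by
  by_cases hij : i + 1 = j
  · have : g + i • d = (i + 2) • d + (g - d - d) := by
      rw [show i + 2 = i + 1 + 1 from rfl, succ_nsmul, succ_nsmul]; abel
    rw [this]
    exact add_mem_add (nsmul_mem_oneHole hd hA hℓ (by omega) (by omega) (by omega)) hg2
  · exact add_nsmul_mem_add_of_gapStart hd hA hℓ (by omega) hg hi hij

/-- `B ⊆ A + B` and `|(A + B) ∖ B| = |A + B| − |B|`, because `0 ∈ A` (`j ≠ 0`).
[cite: Grynkiewicz2009, Lemma 5.10 (proof)] -/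
theorem card_add_sdiff_of_oneHole [Fintype G] {A B : Finset G} {d : G} {ℓ j : ℕ}
    (hd : AddSubgroup.zmultiples d = ⊤) (hA : A = (apFinset (0 : G) d (ℓ + 1)).erase (j • d))
    (hℓ : ℓ < Fintype.card G) (hj : 1 ≤ j) (hjℓ : j ≤ ℓ) :
    B ⊆ A + B ∧ #((A + B) \ B) + #B = #(A + B) := by
  have h0 : (0 : G) ∈ A := by
    have := nsmul_mem_oneHole (k := 0) hd hA hℓ hjℓ (by omega) (by omega)
    rwa [zero_nsmul] at this
  have hsub : B ⊆ A + B := fun b hb => by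
    have := add_mem_add h0 hb; rwa [zero_add] at this
  exact ⟨hsub, card_sdiff_add_card_eq_card hsub⟩

/-- **«`|A + B| = |B| + 3` implies `c ≤ 3`»**, generally `c_d(B) ≤ |(A + B) ∖ B|`: every gap start
`g = (g − d) + d` lies in `(A + B) ∖ B` (`d ∈ A` as `j ≠ 1`). [cite: Grynkiewicz2009, Lemma 5.10
(proof)] -/
theorem componentCount_le_of_oneHole [Fintype G] {A B : Finset G} {d : G} {ℓ j : ℕ}
    (hd : AddSubgroup.zmultiples d = ⊤) (hA : A = (apFinset (0 : G) d (ℓ + 1)).erase (j • d))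
    (hℓ : ℓ < Fintype.card G) (hj2 : 2 ≤ j) (hjℓ : j ≤ ℓ) :
    componentCount d B ≤ #((A + B) \ B) := by
  rw [componentCount_eq_card_vadd_sdiff]
  refine card_le_card fun g hg => ?_
  rw [mem_vadd_sdiff_iff] at hg
  rw [mem_sdiff]
  refine ⟨?_, hg.1⟩
  have := add_nsmul_mem_add_of_gapStart (i := 0) hd hA hℓ hjℓ hg.2 (by omega) (by omega)
  rwa [zero_nsmul, add_zero] at this


/-! ### The case `c_d(B) = 2` -/

/-- **Two gaps, the short one is a single hole.**  In the normalised position, with exactly the two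
gap starts `g₀ ≠ g₁`, if the gap at `g₀` is long (`m_{g₀} ≥ ℓ = |A|`) then the gap at `g₁` has
length `1`: otherwise `(A + B) ∖ B`, of size `|A + B| − |B| = ℓ`, would contain `ℓ + 1` elements —
the `ℓ` (or `ℓ − 1`, if `g₀ − 2d ∉ B`) first elements of the long gap and `g₁` (and `g₁ + d`, as
then `g₁ − 2d ∈ B`: «Since `|B| ≥ 3` and since `c ≤ 2`, it follows that at most one `B_i` can have
cardinality one. Hence from (38) it follows that `|A + B| ≥ |A| + |B| + d⊆(B, 𝒬𝒜𝒫_d) − 1`,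
whence `d⊆(B, 𝒬𝒜𝒫_d) = 1`»). [cite: Grynkiewicz2009, Lemma 5.10 (proof)] -/
theorem gapLength_eq_one_of_long [Fintype G] {A B : Finset G} {d : G} {ℓ j : ℕ} {m : G → ℕ}
    {g₀ g₁ : G} (hd : AddSubgroup.zmultiples d = ⊤)
    (hA : A = (apFinset (0 : G) d (ℓ + 1)).erase (j • d)) (hj2 : 2 ≤ j) (hjℓ : j + 1 ≤ ℓ)
    (hB3 : 3 ≤ #B) (hS : #((A + B) \ B) = ℓ) (hℓn : ℓ < Fintype.card G)
    (hc2 : componentCount d B = 2)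
    (hm : ∀ g, g ∉ B → 1 ≤ m g ∧ m g < Fintype.card G ∧ g + m g • d ∈ B ∧ ∀ i < m g, g + i • d ∉ B)
    (hg₀ : g₀ ∉ B ∧ g₀ - d ∈ B) (hg₁ : g₁ ∉ B ∧ g₁ - d ∈ B) (hne : g₀ ≠ g₁)
    (honly : ∀ g, g ∉ B → g - d ∈ B → g = g₀ ∨ g = g₁) (hlong : ℓ ≤ m g₀) : m g₁ = 1 := by
  have hord : addOrderOf d = Fintype.card G :=
    Isoperimetric.addOrderOf_eq_card_of_zmultiples_eq_top hd
  have hmin : ∀ g, g ∉ B → ∀ i < m g, g + i • d ∉ B := fun g hg => (hm g hg).2.2.2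
  have hBc : Bᶜ.Nonempty := ⟨g₀, mem_compl.2 hg₀.1⟩
  -- at most one of the two components is a singleton
  have htwo : g₀ - d - d ∈ B ∨ g₁ - d - d ∈ B := by
    by_contra hno
    push Not at hno
    have hall : ∀ b ∈ B, b + d ∉ B := fun b hb hbd => by
      obtain ⟨g, hgB, hgd, hg2⟩ := exists_gapStart_sub_two_mem hd hBc hb hbd
      rcases honly g hgB hgd with rfl | rfl
      · exact hno.1 hg2
      · exact hno.2 hg2
    have := card_le_componentCount_of_forall hall
    omega
  by_contra hm1
  have hm1' : 2 ≤ m g₁ := by have := (hm g₁ hg₁.1).1; omega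
  -- the first `ℓ` elements of the long gap
  set P := apFinset g₀ d ℓ with hPdef
  have hPcard : #P = ℓ := card_apFinset_of_addOrderOf g₀ d (Or.inr (by omega))
  have hmemP : ∀ x, x ∈ P ↔ ∃ i, i < ℓ ∧ g₀ + i • d = x := fun x => mem_apFinset
  have hPB : ∀ x ∈ P, x ∉ B := fun x hx => by
    obtain ⟨i, hi, rfl⟩ := (hmemP x).1 hx
    exact hmin g₀ hg₀.1 i (by omega)
  have hg₁P : ∀ i < m g₁, g₁ + i • d ∉ P := fun i hi hx => by
    obtain ⟨i', hi', h⟩ := (hmemP _).1 hx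
    exact hne (eq_of_gap_eq hmin hg₀.2 hg₀.1 hg₁.2 hg₁.1 (by omega) hi h).1
  have hg₁S : g₁ ∈ (A + B) \ B := by
    rw [mem_sdiff]
    refine ⟨?_, hg₁.1⟩
    have := add_nsmul_mem_add_of_gapStart (i := 0) hd hA hℓn (by omega) hg₁.2 (by omega) (by omega)
    rwa [zero_nsmul, add_zero] at this
  rcases htwo with h₀2 | h₁2
  · -- all of `P`, and `g₁`: `ℓ + 1` elements
    have hsub : insert g₁ P ⊆ (A + B) \ B := by
      intro x hx
      rw [mem_insert] at hx
      rcases hx with rfl | hx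
      · exact hg₁S
      · obtain ⟨i, hi, rfl⟩ := (hmemP x).1 hx
        exact mem_sdiff.2 ⟨add_nsmul_mem_add_of_gapStart' hd hA hℓn hjℓ hg₀.2 h₀2 hi,
          hmin g₀ hg₀.1 i (by omega)⟩
    have := card_le_card hsub
    have hnot : g₁ ∉ P := by
      have := hg₁P 0 (by omega); rwa [zero_nsmul, add_zero] at this
    rw [card_insert_of_notMem hnot, hPcard] at this
    omega
  · -- `P` minus one element, `g₁` and `g₁ + d`: `ℓ + 1` elements
    have hsub : insert g₁ (insert (g₁ + d) (P.erase (g₀ + (j - 1) • d))) ⊆ (A + B) \ B := by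
      intro x hx
      rw [mem_insert, mem_insert] at hx
      rcases hx with rfl | rfl | hx
      · exact hg₁S
      · have := add_nsmul_mem_add_of_gapStart' (i := 1) hd hA hℓn hjℓ hg₁.2 h₁2 (by omega)
        rw [one_nsmul] at this
        refine mem_sdiff.2 ⟨this, ?_⟩
        have := hmin g₁ hg₁.1 1 (by omega)
        rwa [one_nsmul] at this
      · rw [mem_erase] at hx
        obtain ⟨hxj, hxP⟩ := hx
        obtain ⟨i, hi, rfl⟩ := (hmemP x).1 hxP
        have hij : i + 1 ≠ j := by
          rintro rfl
          exact hxj (by rw [Nat.add_sub_cancel])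
        exact mem_sdiff.2 ⟨add_nsmul_mem_add_of_gapStart hd hA hℓn (by omega) hg₀.2 hi hij,
          hmin g₀ hg₀.1 i (by omega)⟩
    have := card_le_card hsub
    have hjP : g₀ + (j - 1) • d ∈ P := (hmemP _).2 ⟨j - 1, by omega, rfl⟩
    have h1 : g₁ + d ∉ P.erase (g₀ + (j - 1) • d) := fun h => by
      have := hg₁P 1 (by omega); rw [one_nsmul] at this; exact this (mem_of_mem_erase h)
    have h2 : g₁ ∉ insert (g₁ + d) (P.erase (g₀ + (j - 1) • d)) := by
      rw [mem_insert, not_or]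
      refine ⟨fun h => ?_, fun h => ?_⟩
      · have h' : g₁ + (0 : ℕ) • d = g₁ + (1 : ℕ) • d := by rw [zero_nsmul, one_nsmul, add_zero]; exact h
        have := (eq_of_gap_eq hmin hg₁.2 hg₁.1 hg₁.2 hg₁.1 (by omega) (by omega) h').2
        omega
      · have := hg₁P 0 (by omega); rw [zero_nsmul, add_zero] at this
        exact this (mem_of_mem_erase h)
    rw [card_insert_of_notMem h2, card_insert_of_notMem h1, card_erase_of_mem hjP, hPcard] at this
    omega

/-- **The conclusion from a single hole.**  If the gap starts are exactly `g₀ ≠ g₁` and the gap at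
`g₁` is the single element `g₁`, then `B ∪ {g₁} = G ∖ {g₀, …, g₀ + (m_{g₀} − 1) d}` is an arithmetic
progression with difference `d` not filling `G` (so `B ∪ {g₁} ∈ 𝒬𝒜𝒫_d`), and
`|{0, d, …, ℓ d} + (B ∪ {g₁})| = ℓ + 1 + |B|` as long as `ℓ + |B| + 1 ≤ |G|` («Letting `α` be the hole
in `A`, and letting `β` be the hole in `B` yields (17)» — `{0, …, ℓ d} = A ∪ {α}`).
[cite: Grynkiewicz2009, Lemma 5.10 (proof, last paragraph)] -/
theorem oneHole_conclusion [Fintype G] {B : Finset G} {d : G} {ℓ : ℕ} {m : G → ℕ} {g₀ g₁ : G}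
    (hd : AddSubgroup.zmultiples d = ⊤) (hsmall : ℓ + #B + 2 ≤ Fintype.card G)
    (hm : ∀ g, g ∉ B → 1 ≤ m g ∧ m g < Fintype.card G ∧ g + m g • d ∈ B ∧ ∀ i < m g, g + i • d ∉ B)
    (hg₀ : g₀ ∉ B ∧ g₀ - d ∈ B) (hg₁ : g₁ ∉ B ∧ g₁ - d ∈ B) (hne : g₀ ≠ g₁)
    (honly : ∀ g, g ∉ B → g - d ∈ B → g = g₀ ∨ g = g₁) (hone : m g₁ = 1) :
    IsAP (insert g₁ B) d ∧ IsQuasiProgression d (insert g₁ B) ∧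
      #(apFinset (0 : G) d (ℓ + 1) + insert g₁ B) = ℓ + 1 + #B := by
  have hord : addOrderOf d = Fintype.card G :=
    Isoperimetric.addOrderOf_eq_card_of_zmultiples_eq_top hd
  have hBne : B.Nonempty := ⟨g₀ - d, hg₀.2⟩
  have hmin : ∀ g, g ∉ B → ∀ i < m g, g + i • d ∉ B := fun g hg => (hm g hg).2.2.2
  have hret : ∀ g, g ∉ B → g + m g • d ∈ B := fun g hg => (hm g hg).2.2.1
  have hTcard : #(apFinset g₀ d (m g₀)) = m g₀ :=
    card_apFinset_of_addOrderOf g₀ d (Or.inr (by rw [hord]; exact (hm g₀ hg₀.1).2.1.le))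
  -- `B ∪ {g₁}` is the complement of the long gap
  have hcompl : insert g₁ B = (apFinset g₀ d (m g₀))ᶜ := by
    ext x
    rw [mem_insert, mem_compl, mem_apFinset]
    constructor
    · rintro (rfl | hxB) ⟨i, hi, h⟩
      · have h' : g₀ + i • d = x + (0 : ℕ) • d := by rw [zero_nsmul, add_zero]; exact h
        exact hne (eq_of_gap_eq hmin hg₀.2 hg₀.1 hg₁.2 hg₁.1 hi (by omega) h').1
      · exact hmin g₀ hg₀.1 i hi (h ▸ hxB)
    · intro hx
      by_cases hxB : x ∈ B
      · exact Or.inr hxB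
      · obtain ⟨g, hgB, hgd, i, hi, rfl⟩ := exists_gapStart_of_notMem hd hBne hret hxB
        rcases honly g hgB hgd with rfl | rfl
        · exact (hx ⟨i, hi, rfl⟩).elim
        · left
          rw [hone] at hi
          interval_cases i
          rw [zero_nsmul, add_zero]
  have hAP : IsAP (insert g₁ B) d := by
    rw [hcompl]
    exact IsAP.compl_of_zmultiples_eq_top hd ⟨g₀, by rw [hTcard]⟩
  have hcard : #(insert g₁ B) = #B + 1 := card_insert_of_notMem hg₁.1
  obtain ⟨s, hs⟩ := hAP
  rw [hcard] at hs
  refine ⟨⟨s, by rw [hcard]; exact hs⟩, ?_, ?_⟩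
  · rw [hs]
    exact isQuasiProgression_apFinset (by omega)
      (card_apFinset_of_addOrderOf s d (Or.inr (by rw [hord]; omega)))
  · rw [hs, Isoperimetric.apFinset_add_apFinset 0 s d (by omega) (by omega),
      card_apFinset_of_addOrderOf _ d (Or.inr (by rw [hord]; omega))]
    omega

/-- **The counting core of Lemma 5.10, case `c_d(B) = 2`** (normalised position): with
`A = {0, d, …, ℓ d} ∖ {j d}`, `2 ≤ j ≤ ℓ − 1`, `⟨d⟩ = G`, `|B| ≥ 3`, `|A + B| = |A| + |B|`,
`|\overline{A + B}| ≥ 3` and `c_d(B) = 2`, there is a hole `β ∉ B` with `B ∪ {β}` an arithmetic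
progression with difference `d` lying in `𝒬𝒜𝒫_d` (so `d⊆(B, 𝒬𝒜𝒫_d) = 1`) and
`|(A ∪ {j d}) + (B ∪ {β})| = |A ∪ {j d}| + |B ∪ {β}| − 1`, i.e. (17).  («Hence if `|B'_i| < |A|`
for all `i`, then `|A + B| ≥ |⟨A⟩| − c ≥ |G| − 2`, contradicting `d⊆(A + B, 𝒫) ≥ 3`.  Thus … we
can assume `|B'_c| ≥ |A|`» — then `gapLength_eq_one_of_long` and `oneHole_conclusion`.)
[cite: Grynkiewicz2009, Lemma 5.10 (proof)] -/
theorem oneHole_two_gaps [Fintype G] {A B : Finset G} {d : G} {ℓ j : ℕ}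
    (hd : AddSubgroup.zmultiples d = ⊤) (hA : A = (apFinset (0 : G) d (ℓ + 1)).erase (j • d))
    (hj2 : 2 ≤ j) (hjℓ : j + 1 ≤ ℓ) (hB3 : 3 ≤ #B) (hAB : #(A + B) = ℓ + #B)
    (hsmall : #(A + B) + 3 ≤ Fintype.card G) (hc2 : componentCount d B = 2) :
    ∃ β, β ∉ B ∧ IsAP (insert β B) d ∧ IsQuasiProgression d (insert β B) ∧
      #(apFinset (0 : G) d (ℓ + 1) + insert β B) = ℓ + 1 + #B := by
  have hℓn : ℓ < Fintype.card G := by omega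
  have hBne : B.Nonempty := card_pos.1 (by omega)
  obtain ⟨hBsub, hS⟩ := card_add_sdiff_of_oneHole (B := B) hd hA hℓn (by omega) (by omega)
  replace hS : #((A + B) \ B) = ℓ := by omega
  -- the two gap starts
  have hGs : #((d +ᵥ B) \ B) = 2 := by rw [← componentCount_eq_card_vadd_sdiff, hc2]
  obtain ⟨g₀, g₁, hne, hGs01⟩ := card_eq_two.1 hGs
  have hg₀ : g₀ ∉ B ∧ g₀ - d ∈ B :=
    mem_vadd_sdiff_iff.1 (by rw [hGs01]; exact mem_insert_self _ _)
  have hg₁ : g₁ ∉ B ∧ g₁ - d ∈ B :=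
    mem_vadd_sdiff_iff.1 (by rw [hGs01]; exact mem_insert_of_mem (mem_singleton_self _))
  have honly : ∀ g, g ∉ B → g - d ∈ B → g = g₀ ∨ g = g₁ := fun g h1 h2 => by
    have : g ∈ (d +ᵥ B) \ B := mem_vadd_sdiff_iff.2 ⟨h1, h2⟩
    rwa [hGs01, mem_insert, mem_singleton] at this
  have honly' : ∀ g, g ∉ B → g - d ∈ B → g = g₁ ∨ g = g₀ := fun g h1 h2 =>
    (honly g h1 h2).symm
  obtain ⟨m, hm⟩ := exists_gapLength hd hBne
  have hmin : ∀ g, g ∉ B → ∀ i < m g, g + i • d ∉ B := fun g hg => (hm g hg).2.2.2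
  have hret : ∀ g, g ∉ B → g + m g • d ∈ B := fun g hg => (hm g hg).2.2.1
  have hsmall' : ℓ + #B + 2 ≤ Fintype.card G := by omega
  by_cases h₀ : ℓ ≤ m g₀
  · have h1 := gapLength_eq_one_of_long hd hA hj2 hjℓ hB3 hS hℓn hc2 hm hg₀ hg₁ hne honly h₀
    exact ⟨g₁, hg₁.1, oneHole_conclusion hd hsmall' hm hg₀ hg₁ hne honly h1⟩
  by_cases h₁ : ℓ ≤ m g₁
  · have h1 := gapLength_eq_one_of_long hd hA hj2 hjℓ hB3 hS hℓn hc2 hm hg₁ hg₀ hne.symm honly' h₁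
    exact ⟨g₀, hg₀.1, oneHole_conclusion hd hsmall' hm hg₁ hg₀ hne.symm honly' h1⟩
  -- both gaps short: `\overline{A + B} ⊆ {g₀ + (j−1)d, g₁ + (j−1)d}`
  exfalso
  push Not at h₀ h₁
  have hsub : (A + B)ᶜ ⊆ {g₀ + (j - 1) • d, g₁ + (j - 1) • d} := by
    intro x hx
    rw [mem_compl] at hx
    have hxB : x ∉ B := fun h => hx (hBsub h)
    obtain ⟨g, hgB, hgd, i, hi, rfl⟩ := exists_gapStart_of_notMem hd hBne hret hxB
    have hiℓ : i < ℓ := by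
      rcases honly g hgB hgd with rfl | rfl <;> omega
    have hij : i + 1 = j := by
      by_contra hij
      exact hx (add_nsmul_mem_add_of_gapStart hd hA hℓn (by omega) hgd hiℓ hij)
    have hi' : i = j - 1 := by omega
    subst hi'
    rw [mem_insert, mem_singleton]
    rcases honly g hgB hgd with rfl | rfl
    · exact Or.inl rfl
    · exact Or.inr rfl
  have h1 := (card_le_card hsub).trans (card_insert_le _ _)
  rw [card_singleton, card_compl] at h1
  omega

/-! ### The case `|A| = 3`, `c_d(B) = 3` -/

/-- **The counting core of Lemma 5.10, case `|A| = 3` with three gaps** (normalised position,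
`A = {0, d, 3d}`): impossible once `|\overline{A + B}| ≥ 4` — if every gap is shorter than `3` then
`\overline{A + B} ⊆ {g₀ + d, g₁ + d, g₂ + d}`; otherwise a long gap at `g` puts `g, g + 2d` into
`(A + B) ∖ B` next to the other two gap starts, four elements in a set of size `|A + B| − |B| = 3`
(«Therefore assume `c = 3`. Hence, since each `B'_i` contributes at least one to the sumset, and
since `B'_3` contributes at least `|A| − 1` …, it follows that `|A + B| ≥ |B| + |A| − 1 + (c − 1) >
|A| + |B|`, again a contradiction»). [cite: Grynkiewicz2009, Lemma 5.10 (proof)] -/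
theorem oneHole_three_gaps [Fintype G] {A B : Finset G} {d : G}
    (hd : AddSubgroup.zmultiples d = ⊤) (hA : A = (apFinset (0 : G) d (3 + 1)).erase (2 • d))
    (hAB : #(A + B) = 3 + #B) (hC4 : #(A + B) + 4 ≤ Fintype.card G)
    (hc3 : componentCount d B = 3) : False := by
  have hℓn : 3 < Fintype.card G := by omega
  have hBne : B.Nonempty := by
    rw [nonempty_iff_ne_empty]
    rintro rfl
    rw [componentCount, empty_add, card_empty] at hc3
    exact absurd hc3 (by norm_num)
  obtain ⟨hBsub, hS⟩ := card_add_sdiff_of_oneHole (B := B) hd hA hℓn (by omega) (by omega)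
  replace hS : #((A + B) \ B) = 3 := by omega
  have hGs : #((d +ᵥ B) \ B) = 3 := by rw [← componentCount_eq_card_vadd_sdiff, hc3]
  obtain ⟨g₀, g₁, g₂, h01, h02, h12, hGs012⟩ := card_eq_three.1 hGs
  have hGsub : (d +ᵥ B) \ B ⊆ (A + B) \ B := by
    have := componentCount_le_of_oneHole (B := B) hd hA hℓn (le_refl 2) (by omega)
    intro g hg
    rw [mem_vadd_sdiff_iff] at hg
    rw [mem_sdiff]
    refine ⟨?_, hg.1⟩
    have := add_nsmul_mem_add_of_gapStart (i := 0) hd hA hℓn (by omega) hg.2 (by omega) (by omega)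
    rwa [zero_nsmul, add_zero] at this
  have honly : ∀ g, g ∉ B → g - d ∈ B → g = g₀ ∨ g = g₁ ∨ g = g₂ := fun g h1 h2 => by
    have : g ∈ (d +ᵥ B) \ B := mem_vadd_sdiff_iff.2 ⟨h1, h2⟩
    rwa [hGs012, mem_insert, mem_insert, mem_singleton] at this
  obtain ⟨m, hm⟩ := exists_gapLength hd hBne
  have hmin : ∀ g, g ∉ B → ∀ i < m g, g + i • d ∉ B := fun g hg => (hm g hg).2.2.2
  have hret : ∀ g, g ∉ B → g + m g • d ∈ B := fun g hg => (hm g hg).2.2.1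
  -- a long gap is impossible
  have key : ∀ g, g ∉ B → g - d ∈ B → 3 ≤ m g → False := by
    intro g hgB hgd hlong
    have hg2 : g + 2 • d ∈ (A + B) \ B :=
      mem_sdiff.2 ⟨add_nsmul_mem_add_of_gapStart hd hA hℓn (by omega) hgd (by omega) (by omega),
        hmin g hgB 2 (by omega)⟩
    have hnot : g + 2 • d ∉ (d +ᵥ B) \ B := fun h => by
      rw [mem_vadd_sdiff_iff] at h
      have h' : g + 2 • d = (g + 2 • d) + (0 : ℕ) • d := by rw [zero_nsmul, add_zero]
      have := (eq_of_gap_eq hmin hgd hgB h.2 h.1 hlong (hm _ h.1).1 h').2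
      omega
    have hsub : insert (g + 2 • d) ((d +ᵥ B) \ B) ⊆ (A + B) \ B := by
      intro x hx
      rw [mem_insert] at hx
      rcases hx with rfl | hx
      · exact hg2
      · exact hGsub hx
    have := card_le_card hsub
    rw [card_insert_of_notMem hnot, hGs] at this
    omega
  -- so every gap is shorter than `3`, and `\overline{A + B} ⊆ {g₀ + d, g₁ + d, g₂ + d}`
  have hsub : (A + B)ᶜ ⊆ {g₀ + d, g₁ + d, g₂ + d} := by
    intro x hx
    rw [mem_compl] at hx
    have hxB : x ∉ B := fun h => hx (hBsub h)
    obtain ⟨g, hgB, hgd, i, hi, rfl⟩ := exists_gapStart_of_notMem hd hBne hret hxB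
    have hm3 : m g < 3 := by
      by_contra h3
      exact key g hgB hgd (by omega)
    have hij : i + 1 = 2 := by
      by_contra hij
      exact hx (add_nsmul_mem_add_of_gapStart hd hA hℓn (by omega) hgd (by omega) hij)
    have hi' : i = 1 := by omega
    subst hi'
    rw [one_nsmul, mem_insert, mem_insert, mem_singleton]
    rcases honly g hgB hgd with rfl | rfl | rfl
    · exact Or.inl rfl
    · exact Or.inr (Or.inl rfl)
    · exact Or.inr (Or.inr rfl)
  have h1 := (card_le_card hsub).trans ((card_insert_le _ _).trans (Nat.succ_le_succ (card_insert_le _ _)))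
  rw [card_singleton, card_compl] at h1
  omega

end Grynkiewicz2009

end Literature.Combinatorics.Additive
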